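import Summits.CriticalPhenomena.PercolationContinuityZ3.Theorems.PercNearOneGluingNoHeavyLowerTailSahiCombShape

/-!
# The comb (tensor-Bernstein) hierarchy for Sahi's `E_k`, VII: UNIQUENESS of tensor-Bernstein coefficients —
# the explicit master statement (M⁺-k) and P3's existential certificate class coincide

Support file of the one-cut programme (crux `NoHeavyLowerTail`, stmt-CriticalPhenomena-4575; cell `prim-masterthm`, seat P5).
P3's `CombPos c F` (`…SahiCombPositivity`) asks for SOME nonnegative representation of `F` in the degree-`c` tensor-Bernstein basis;
`…SahiCombCopyKernel` constructs THE coefficients `combCoeff` of `p ↦ E_n(μ_p; f)`.  The basis `∏_e p_e^{j_e}(1−p_e)^{c_e−j_e}`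
(`j ≤ c`) is a basis, so the two agree; this file proves it (P3's docstrings assert the uniqueness "not used / not proved").

* `SahiComb.eq_zero_of_sum_mul_pow_mul_one_sub_pow_eq_zero` — univariate: `Σ_{t≤n} g_t x^t(1−x)^{n−t} = 0` on `[0,1]` forces
  `g = 0` (substitute `x = r/(1+r)`: the polynomial `Σ g_t X^t` vanishes on `[0,∞)`);
* `SahiComb.bern_update_param`, `SahiComb.sum_box_eq_sum_fiber_update` — peeling one coordinate off a basis function / off the box;
* **`SahiComb.eq_zero_of_sum_bern_eq_zero`**, **`SahiComb.bern_coeff_unique`** — multivariate uniqueness on `[0,1]^ι`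
  (induction on the coordinates);
* **`SahiComb.combPos_sahiE_iff_combCoeff_nonneg`** — for every function family, `CombPos n (p ↦ E_n(μ_p; f))` iff all
  `combCoeff(f; j) ≥ 0`; hence **`masterFamilyCombCoeffNonneg_iff_masterFamilyCombPos`**: (M⁺-k) with THE coefficients
  (`…SahiCombShape`) ⟺ P3's `MasterFamilyCombPos k`, and `combEndPos_iff_masterFamilyCombPos`.
Everything here is proved; axioms standard. [this work]
-/

noncomputable section

open scoped Classical

namespace Summit.CriticalPhenomena.PercolationContinuityZ3.Theorems

open Finset Function
open Literature.Combinatorics.Sahi2008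
open SahiComb

namespace SahiComb

/-! ### Univariate uniqueness -/

/-- **Univariate Bernstein uniqueness**: if `Σ_{t ≤ n} g_t · x^t(1−x)^{n−t} = 0` for all `x ∈ [0,1]` then `g_t = 0` for
`t ≤ n` (the polynomial `Σ_t g_t X^t` vanishes at every `r ≥ 0`, via `x = r/(1+r)`). [folklore] -/
theorem eq_zero_of_sum_mul_pow_mul_one_sub_pow_eq_zero {n : ℕ} {g : ℕ → ℝ}
    (h : ∀ x : ℝ, 0 ≤ x → x ≤ 1 → ∑ t ∈ range (n + 1), g t * (x ^ t * (1 - x) ^ (n - t)) = 0) :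
    ∀ t, t ≤ n → g t = 0 := by
  set P : Polynomial ℝ := ∑ t ∈ range (n + 1), Polynomial.C (g t) * Polynomial.X ^ t with hP
  have hroot : ∀ r : ℝ, 0 ≤ r → P.IsRoot r := by
    intro r hr
    have h1 : (0 : ℝ) < 1 + r := by linarith
    have hx0 : 0 ≤ r / (1 + r) := div_nonneg hr h1.le
    have hx1 : r / (1 + r) ≤ 1 := by rw [div_le_one h1]; linarith
    have key := h _ hx0 hx1
    have h1r : 1 - r / (1 + r) = 1 / (1 + r) := by
      field_simp
      ring
    have hterm : ∀ t ∈ range (n + 1),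
        (1 + r) ^ n * (g t * ((r / (1 + r)) ^ t * (1 - r / (1 + r)) ^ (n - t))) = g t * r ^ t := by
      intro t ht
      have htn : t ≤ n := Nat.lt_succ_iff.1 (mem_range.1 ht)
      have hb : (r / (1 + r)) ^ t * (1 - r / (1 + r)) ^ (n - t) = r ^ t / (1 + r) ^ n := by
        rw [h1r, div_pow, div_pow, one_pow, div_mul_div_comm, mul_one, ← pow_add, Nat.add_sub_cancel' htn]
      rw [hb]
      field_simp
    simp only [Polynomial.IsRoot, hP, Polynomial.eval_finsetSum, Polynomial.eval_mul, Polynomial.eval_C,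
      Polynomial.eval_pow, Polynomial.eval_X]
    rw [← sum_congr rfl hterm, ← mul_sum, key, mul_zero]
  have hP0 : P = 0 :=
    Polynomial.eq_zero_of_infinite_isRoot P ((Set.Ici_infinite (0 : ℝ)).mono fun r hr => hroot r hr)
  intro t ht
  have hc : P.coeff t = g t := by
    rw [hP, Polynomial.finsetSum_coeff]
    simp only [Polynomial.coeff_C_mul_X_pow]
    rw [sum_ite_eq, if_pos (mem_range.2 (Nat.lt_succ_of_le ht))]
  rw [← hc, hP0, Polynomial.coeff_zero]

/-! ### Peeling one coordinate off the basis and off the box -/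

variable {ι : Type*} [Fintype ι]

/-- A basis function at a parameter updated in `e` factors into its `e`-part and the basis function of the restricted
multidegree / profile. [folklore] -/
theorem bern_update_param (c j : ι → ℕ) (p : ι → unitInterval) (e : ι) (s : unitInterval) :
    bern c j (update p e s) =
      ((s : ℝ) ^ (j e) * (1 - (s : ℝ)) ^ (c e - j e)) * bern (update c e 0) (update j e 0) p := by
  unfold bern
  rw [← prod_erase_mul univ _ (mem_univ e),
    ← prod_erase_mul univ (fun e' => (p e' : ℝ) ^ (update j e 0 e') * (1 - (p e' : ℝ)) ^ (update c e 0 e' - update j e 0 e'))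
      (mem_univ e)]
  simp only [update_self, pow_zero, Nat.sub_zero, mul_one]
  rw [mul_comm]
  congr 1
  refine prod_congr rfl fun e' he' => ?_
  have hne : e' ≠ e := ne_of_mem_erase he'
  rw [update_of_ne hne, update_of_ne hne, update_of_ne hne]

/-- The box of multidegree `c` fibres over the `e`-coordinate into copies of the box of `c[e ↦ 0]`. [folklore] -/
theorem sum_box_eq_sum_fiber_update (c : ι → ℕ) (e : ι) (G : (ι → ℕ) → ℝ) :
    ∑ j ∈ box c, G j = ∑ t ∈ range (c e + 1), ∑ j' ∈ box (update c e 0), G (update j' e t) := by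
  rw [← sum_fiberwise_of_maps_to (s := box c) (t := range (c e + 1)) (g := fun j => j e)
    (fun j hj => mem_range.2 (Nat.lt_succ_of_le (mem_box.1 hj e)))]
  refine sum_congr rfl fun t ht => ?_
  have htc : t ≤ c e := Nat.lt_succ_iff.1 (mem_range.1 ht)
  refine sum_nbij' (fun j => update j e 0) (fun j' => update j' e t) ?_ ?_ ?_ ?_ ?_
  · intro j hj
    have hjb := (mem_filter.1 hj).1
    rw [mem_box] at hjb ⊢
    intro e'
    by_cases hee : e' = e
    · subst hee; simp
    · rw [update_of_ne hee, update_of_ne hee]; exact hjb e'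
  · intro j' hj'
    rw [mem_box] at hj'
    refine mem_filter.2 ⟨mem_box.2 fun e' => ?_, update_self e t j'⟩
    by_cases hee : e' = e
    · subst hee; rw [update_self]; exact htc
    · rw [update_of_ne hee]; have := hj' e'; rwa [update_of_ne hee] at this
  · intro j hj
    have hje : j e = t := (mem_filter.1 hj).2
    rw [update_idem, ← hje, update_eq_self]
  · intro j' hj'
    have hje : j' e = 0 := Nat.le_zero.1 (by simpa using mem_box.1 hj' e)
    rw [update_idem, ← hje, update_eq_self]
  · intro j hj
    have hje : j e = t := (mem_filter.1 hj).2
    rw [update_idem, ← hje, update_eq_self]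

/-! ### Multivariate uniqueness -/

/-- Uniqueness on the cube, by induction on a coordinate set carrying the multidegree. [folklore] -/
theorem eq_zero_of_sum_bern_eq_zero_aux (S : Finset ι) :
    ∀ (c : ι → ℕ), (∀ e, e ∉ S → c e = 0) → ∀ (N : (ι → ℕ) → ℝ),
      (∀ p : ι → unitInterval, ∑ j ∈ box c, N j * bern c j p = 0) → ∀ j ∈ box c, N j = 0 := by
  induction S using Finset.induction_on with
  | empty =>
    intro c hc N hN j hj
    have hc0 : c = fun _ => 0 := funext fun e => hc e (notMem_empty e)
    subst hc0
    have hj0 : j = fun _ => 0 := funext fun e => Nat.le_zero.1 (mem_box.1 hj e)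
    subst hj0
    have hbox : box (fun _ : ι => (0 : ℕ)) = {fun _ => 0} := by
      ext j
      rw [mem_box, mem_singleton]
      constructor
      · intro h'; funext e; exact Nat.le_zero.1 (h' e)
      · rintro rfl e; exact le_rfl
    have h0 := hN fun _ => 0
    rw [hbox, sum_singleton] at h0
    have hb : bern (fun _ : ι => (0 : ℕ)) (fun _ => 0) (fun _ => (0 : unitInterval)) = 1 := by
      unfold bern
      simp
    rwa [hb, mul_one] at h0
  | insert e S heS ih =>
    intro c hc N hN j hj
    have hc' : ∀ e', e' ∉ S → update c e 0 e' = 0 := by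
      intro e' he'
      by_cases hee : e' = e
      · rw [hee, update_self]
      · rw [update_of_ne hee]
        exact hc e' (by simp [hee, he'])
    have key : ∀ t, t ≤ c e → ∀ p : ι → unitInterval,
        ∑ j' ∈ box (update c e 0), N (update j' e t) * bern (update c e 0) j' p = 0 := by
      intro t ht p
      have hx : ∀ x : ℝ, 0 ≤ x → x ≤ 1 → ∑ s ∈ range (c e + 1),
          (∑ j' ∈ box (update c e 0), N (update j' e s) * bern (update c e 0) j' p) * (x ^ s * (1 - x) ^ (c e - s)) = 0 := by
        intro x hx0 hx1
        have h := hN (update p e ⟨x, hx0, hx1⟩)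
        rw [sum_box_eq_sum_fiber_update c e] at h
        rw [← h]
        refine sum_congr rfl fun s _ => ?_
        rw [sum_mul]
        refine sum_congr rfl fun j' hj' => ?_
        have hje : j' e = 0 := Nat.le_zero.1 (by simpa using mem_box.1 hj' e)
        rw [bern_update_param, update_self, update_idem, ← hje, update_eq_self, hje]
        push_cast
        ring
      exact eq_zero_of_sum_mul_pow_mul_one_sub_pow_eq_zero hx t ht
    have hje : j e ≤ c e := mem_box.1 hj e
    have hj' : update j e 0 ∈ box (update c e 0) := by
      rw [mem_box]
      intro e'
      by_cases hee : e' = e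
      · subst hee; simp
      · rw [update_of_ne hee, update_of_ne hee]; exact mem_box.1 hj e'
    have h := ih (update c e 0) hc' (fun j' => N (update j' e (j e))) (key (j e) hje) (update j e 0) hj'
    simpa only [update_idem, update_eq_self] using h

/-- **If a tensor-Bernstein combination vanishes on the closed cube, all its coefficients vanish.** [folklore] -/
theorem eq_zero_of_sum_bern_eq_zero {c : ι → ℕ} {N : (ι → ℕ) → ℝ}
    (hN : ∀ p : ι → unitInterval, ∑ j ∈ box c, N j * bern c j p = 0) : ∀ j ∈ box c, N j = 0 :=
  eq_zero_of_sum_bern_eq_zero_aux univ c (fun e he => absurd (mem_univ e) he) N hN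

/-- **Uniqueness of tensor-Bernstein coefficients** on `[0,1]^ι`. [folklore] -/
theorem bern_coeff_unique {c : ι → ℕ} {N M : (ι → ℕ) → ℝ}
    (h : ∀ p : ι → unitInterval, ∑ j ∈ box c, N j * bern c j p = ∑ j ∈ box c, M j * bern c j p) :
    ∀ j ∈ box c, N j = M j := by
  intro j hj
  have h0 := eq_zero_of_sum_bern_eq_zero (c := c) (N := fun j => N j - M j)
    (fun p => by simp only [sub_mul, sum_sub_distrib, h p, sub_self]) j hj
  exact sub_eq_zero.1 h0

/-- **Explicit ⟺ existential, per tuple**: `p ↦ E_n(μ_p; f)` is comb-positive at multidegree `n` (P3's `CombPos`) iff all its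
comb coefficients `combCoeff(f; j)` are `≥ 0`. [this work] -/
theorem combPos_sahiE_iff_combCoeff_nonneg {n : ℕ} (f : Fin n → Set ι → ℝ) :
    CombPos (fun _ : ι => n) (fun p => sahiE (bernoulliWeight p) n f) ↔ ∀ j, 0 ≤ combCoeff n f j := by
  refine ⟨fun h j => ?_, combPos_of_combCoeff_nonneg⟩
  obtain ⟨N, hN, hrep⟩ := h
  by_cases hj : j ∈ box (fun _ : ι => n)
  · rw [← bern_coeff_unique (fun p => (hrep p).symm.trans (sahiE_bernoulliWeight_eq_sum_combCoeff p n f)) j hj]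
    exact hN j
  · exact (combCoeff_eq_zero_of_not_mem_box f hj).ge

end SahiComb

/-- **(M⁺-k) with THE coefficients ⟺ P3's existential (M⁺-k).** [this work] -/
theorem masterFamilyCombCoeffNonneg_iff_masterFamilyCombPos (k : ℕ) :
    MasterFamilyCombCoeffNonneg k ↔ MasterFamilyCombPos k :=
  ⟨masterFamilyCombPos_of_combCoeffNonneg, fun h ι _ U hU => (combPos_sahiE_iff_combCoeff_nonneg _).1 (h ι U hU)⟩

/-- **ENDPOS(k) ⟺ P3's (M⁺-k)**: the one-axis propagation law is equivalent to comb positivity of `E_k` on product measures.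
[this work] -/
theorem combEndPos_iff_masterFamilyCombPos (k : ℕ) : CombEndPos k ↔ MasterFamilyCombPos k :=
  (masterFamilyCombCoeffNonneg_iff_combEndPos k).symm.trans (masterFamilyCombCoeffNonneg_iff_masterFamilyCombPos k)

end Summit.CriticalPhenomena.PercolationContinuityZ3.Theorems
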